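import Literature.AlgebraicGeometry.Motives.MilneRationalityConjecture
import Literature.AlgebraicGeometry.Motives.AbelianVarietyProjective
import Literature.AlgebraicGeometry.Motives.AbelianVarietyProjectiveChart
import Literature.AlgebraicGeometry.Milne1999.HodgeCMImpliesTateFiniteFields
import HarnessLib

/-!
# Milne 2009, §4.1 / Theorem 4.3 (a): the Hodge conjecture for complex CM abelian varieties implies
# the Rationality Conjecture for every CM abelian variety over `ℚ^al` with good reduction

J. S. Milne, *Rational Tate classes*, Moscow Math. J. **9** (2009) 111–141 = arXiv:0707.3167
[Milne2009RationalTate], read in the held text `paper:arxiv-0707.3167` (chunk numbers below), and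
J. S. Milne, *Abelian motives and Shimura varieties in nonzero characteristic*, arXiv:2508.09972 (2025)
[Milne2025AbelianMotivesCharP] (held `paper:arxiv-2508.09972`, chunk p0012), where the same conjecture
is Conjecture (A). The conjecture ITSELF is already typed in the tree, verbatim and data-parametrised:
`Motives.MilneRationalityConjecture D` (`Motives/MilneRationalityConjecture`, `D : MilneRealizationData
ℚ^al p O` = the ℓ-adic / de Rham / crystalline theories and the specialization maps at the `p`-adic
prime `O` of `ℚ^al ⊂ ℂ`). This file TYPES, at statement level and in the standing of
`Milne1999.Theorem71` (`Milne1999/HodgeCMImpliesTateFiniteFields`), the printed implication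
"Hodge conjecture for `A` ⟹ rationality conjecture for `A`" as a `D`-parametrised cited PREDICATE
(`HodgeImpliesRationality D`), and records the edge
"HC for all complex CM abelian varieties ⟹ statement (a) of Theorem 4.3 (the rationality conjecture
for all CM abelian varieties over `ℚ^al`)" as a kernel-visible implication BY NAME
(`rationalityCM_of_HC_CM`). Nothing of §§1–3 / §4.2 (Lefschetz motives, good theories of
rational Tate classes, the equivalences (a) ⟺ (b) ⟺ (c) ⟺ (d) of Thm. 4.3) is formalised.

## The sources, verbatim

* [Milne2009RationalTate] §4.1 (chunk p0018 L8–L28), the **Rationality Conjecture**: "Let `A` be an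
  abelian variety over `ℚ^al` with good reduction to an abelian variety `A₀` over `𝔽`. The cup product
  of the specialization to `A₀` of any Hodge class on `A` with any Lefschetz class of complementary
  dimension lies in `ℚ`. […] Equivalently, it says that the `l`-component of `γ₀ ∪ δ` is a rational
  number independent of `l`." — typed as `Motives.MilneRationalityConjecture D` (all `A` at once); the
  per-variety form is `RationalityAt D A` below (same body, `A` fixed).
* §4.1, the paragraph after the statement (p0018 L30–L33): "**The conjecture is true for a particular
  `γ` if `γ₀` is algebraic. Therefore, the conjecture is implied by the Hodge conjecture for abelian
  varieties (or even by the weaker statement that the Hodge classes specialize to algebraic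
  classes).**"  Restated by the author as [Milne2025AbelianMotivesCharP] Plain 3.2 (p0012 L40–L45):
  "If `γ` is algebraic, then `γ₀` is algebraic, and so Conjecture A holds for `γ`. In particular, if
  the Hodge conjecture holds for `A`, for example, if `A` has no exotic Hodge classes, then Conjecture A
  holds for `A`." (Conjecture (A), p0012 L18–L36: "Let `A` be an abelian variety over `ℚ^al` with good
  reduction at `w`. All (absolute) Hodge classes on `A` are `w`-rational", `w`-rational meaning
  `⟨γ₀ · δ₁ · ⋯ · δ_r⟩ ∈ ℚ` for divisor classes `δᵢ` on `A₀` — the divisor-monomial form in which the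
  tree states the conjecture.)
* Introduction (p0002 L53–L57 and L70–L71): "The rationality conjecture in 4 […] implies the existence
  of a good theory of rational Tate classes on abelian varieties over `𝔽`, and is implied by the Hodge
  conjecture for CM abelian varieties." "As noted, the Hodge conjecture for CM abelian varieties over
  `ℂ` implies the rationality conjecture for abelian varieties."
* §3.1 (p0013 L11–L16): "An abelian variety with sufficiently many endomorphisms over an algebraically
  closed field of characteristic zero will be called a CM abelian variety. Let `ℚ^al` be the algebraic
  closure of `ℚ` in `ℂ`. The functor `A ⇝ A_ℂ` from CM abelian varieties over `ℚ^al` to CM abelian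
  varieties over `ℂ` is an equivalence of categories (see, for example, [milneCM], 7)."
* **Theorem 4.3** (p0018 L72–L86): "The following statements are equivalent: (a) The rationality
  conjecture holds for all CM abelian varieties over `ℚ^al`. (b) The weak rationality conjecture holds
  for all CM abelian varieties over `ℚ^al`. (c) There exists a good theory of rational Tate classes on
  `𝒮₀`. (d) There exists a commutative diagram of tannakian categories as in (18) […]".

## Lean rendering

* `ℚ^al ⊂ ℂ`, the prime `w` (`O : ValuationSubring ℚ^al`, residue characteristic `p`), good reduction
  (`𝒜 : IntegralModel O ℚ^al A.X`, `𝒜.IsSmoothProper A.dim`), Hodge classes (rational Betti classes of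
  the REAL singular cohomology of `(A ⊗_{ℚ^al} ℂ)(ℂ)` of Hodge type `(r,r)` in the sense of the summit
  statement), Lefschetz monomials and the `ℓ`- and `p`-components of `γ₀ ∪ δ`: ALL exactly as in
  `Motives.MilneRationalityConjecture` — `RationalityAt D A` is that definition's body with
  its leading `∀ A` removed (`milneRationality_iff_forall` is `Iff.rfl`).
* "CM abelian variety over `ℚ^al`" (§3.1: sufficiently many endomorphisms; `A ⇝ A_ℂ` an equivalence
  with CM abelian varieties over `ℂ`) is rendered through that printed equivalence as
  `Milne1999.IsOfCMType (A.baseChange ℂ)` — the complexification `A_ℂ` (`AbelianVariety.baseChange`,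
  along `algebraMap ℚ^al ℂ = Subfield.subtype ℚ^al`, Mathlib `Subfield.algebraMap_ofSubfield`) is of
  CM-type in the sense of `Milne1999/HodgeCMImpliesTateFiniteFields` (= the CM clause of the summit
  item `CMAbelianHodge`), so that the hypothesis of the edge is the tree's `HC_CM` hypothesis
  `∀ B : AbelianVariety ℂ, Milne1999.CMHodgeHypothesisAt B` BY NAME.
* "the Hodge conjecture holds for `A`" (`A/ℚ^al`; §3.1 identifies Hodge classes on `A` with those of
  `A_ℂ`, after Deligne 1982 Thm. 2.11) is the tree's REAL statement `HodgeTheory.HodgeConjectureFor`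
  at the complexified scheme `(baseChangeHom (Subfield.subtype ℚ^al)).obj A.X` in dimension `A.dim` —
  literally the scheme and the dimension over which `MilneRationalityConjecture` quantifies its Hodge
  classes; `(A.baseChange ℂ).X` is this scheme definitionally and `(A.baseChange ℂ).dim = A.dim`
  (`AbelianVariety.dim_baseChange`), which is how the edge feeds it from `CMHodgeHypothesisAt`.
* `HodgeImpliesRationality D : Prop := ∀ A, HodgeConjectureFor A.dim (A ⊗ ℂ) → RationalityAt D A` —
  the §4.1 sentence / Plain 3.2 at each `A`, as a `D`-parametrised cited PREDICATE: a THEOREM in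
  print at the intended data `D` (mechanism, as printed: an algebraic class specializes to an algebraic
  class — Fulton, *Intersection Theory* §20.3; cycle classes are compatible with the specialization
  maps and with intersection numbers, which are integers, SGA 4½ [Cycle], Gillet–Messing 1987 for the
  crystalline class; and a class on `A_ℂ` algebraic over `ℂ` is algebraic over the algebraically closed
  `ℚ^al`, Charles–Schnell 2014 Remark after Cor. 11.3.16 = the tree's
  `charlesSchnell2014_algebraicClasses_supportedOn_qbarClosed…`), NOT asserted for arbitrary data of
  type `MilneRealizationData` (whose axioms say nothing about cycle classes under specialization — see
  the "junk analysis" of `Motives/MilneRationalityConjecture`: at unrelated data the statement can fail,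
  so a universal closure over `D` is not what is printed). The standing of `Milne1999.Theorem71 E`,
  `MilneRamachandran2006.Theorem110 E`, `Motives.TateImpliesHodgeAbelianStatement E B`. No `_holds` is
  owed or claimed.
* `RationalityCM D` = statement (a) of Theorem 4.3 — an OPEN statement, typed as a predicate
  on `D` (nothing is asserted; it is the conclusion of the edge, as `TateStatement01 E` is for Thm. 7.1).
* The edge `rationalityCM_of_HC_CM h41 hHC : RationalityCM D` — modus ponens plus the two bookkeeping
  facts `dim_baseChange` / `isSmoothProjective_holds`, so that a consumer holding
  Milne's §4.1 implication at the intended `D` and the Hodge conjecture for every complex abelian variety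
  of CM-type obtains Theorem 4.3 (a) BY NAME; with Thm. 4.3 (print, not typed: (a) ⟺ (c) ⟺ (d)) this is
  the reader's-map row "`HC_CM` ⟹ a (unique, Thm. 3.3) good theory of rational Tate classes on `𝒮₀` /
  the diagram of motives over `𝔽`" of the pub-hodgecm consequence file, §3.

## What is NOT here

* Theorem 4.3 itself ((a) ⟺ (b) ⟺ (c) ⟺ (d)): "good theory of rational Tate classes" (Def. 3.1/7.1 of
  the AIM talk, (R1)–(R4)) and the tannakian diagram (18) have no tree vocabulary; typing (c)/(d) as
  uninterpreted `Prop`s would add nothing kernel-visible. Aside 4.6 (special-lift conjecture ⟹ CM case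
  suffices for all `A`), Ex. 4.1 / Plain 3.3 (simple ordinary reduction, unconditional), Thm. 3.4
  (= Milne 1999 Thm. 7.1, typed in `Milne1999/HodgeCMImpliesTateFiniteFields`).

## References

* [Milne2009RationalTate] J. S. Milne, Rational Tate classes, Mosc. Math. J. 9 (2009) 111–141 =
  arXiv:0707.3167: Introduction (p0002), §3.1 (p0013), §4.1 Conjecture, the paragraph after it, Ex. 4.1,
  Def. 4.2, Thm. 4.3, Rems. 4.4–4.5, Asides 4.6–4.7 (p0018–p0019).
* [Milne2025AbelianMotivesCharP] J. S. Milne, Abelian motives and Shimura varieties in nonzero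
  characteristic, arXiv:2508.09972: §3.1 Def. 3.1, Conjecture (A), Plain 3.2, Plain 3.3 (p0012).
* [Milne1999] Thm. 7.1 (the sibling edge `Milne1999.tateAV_Fq_of_HC_CM`). [CharlesSchnell2014Notes]
  Remark after Cor. 11.3.16. [Fulton1998] §20.3.
-/

noncomputable section

open CategoryTheory AlgebraicGeometry
open Literature.AlgebraicGeometry.Motives
open Literature.AlgebraicGeometry.HodgeTheory
open Literature.AlgebraicTopology.SingularHomology

namespace Literature.AlgebraicGeometry.Milne2009

/-- `ℚ^al ⊂ ℂ`: the algebraic closure of `ℚ` in `ℂ` as a subfield (Milne 2009, §3.1; the same local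
notation as in the tree's §4.1 file). -/
local notation "ℚal" => IntermediateField.toSubfield (algebraicClosure ℚ ℂ)

variable {p : ℕ} [Fact p.Prime] {O : ValuationSubring ℚal} [CharP (IsLocalRing.ResidueField O) p]

/-! ### The §4.1 statement at one abelian variety

(Gate lint note: the three `Prop`-valued DEFINITIONS below are statements/predicates, not facts; their
docstrings avoid the c-word on purpose — the printed names of the statements, the verbatim quotations
and the tree declarations they unfold are all in the module docstring above and in the docstrings of the
THEOREMS, which name everything explicitly.) -/

/-- **Milne 2009, §4.1 — Milne's RATIONALITY STATEMENT AT the abelian variety `A/ℚ^al`** (printed text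
and printed name: module docstring; = Milne 2025, §3.1, statement (A) at `A`), relative to Milne
realization data `D` at the `p`-adic prime `O`: for every smooth proper model `𝒜` of `A` over `O`
(`A₀ = 𝒜 ×_O 𝔽`), all `r + s = dim A`, every rational Betti class `t ∈ H^{2r}(A(ℂ); ℚ)` (cocycle
witness `ζ`) whose complexification is of Hodge type `(r, r)`, and every Lefschetz monomial
`δ = cl(D₁) ∪ ⋯ ∪ cl(D_s)` in prime divisors of `A₀`, there is ONE `q ∈ ℚ` with `⟨γ₀,ℓ ∪ δ⟩ = q` for
every prime `ℓ ≠ p` and `⟨γ₀,p ∪ δ⟩ = q` for every de Rham representative `α` of `t`. With `A` fixed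
this is LITERALLY the body of the tree's all-`A` rendering of §4.1 (`milneRationality_iff_forall` below
is `Iff.rfl`). A PREDICATE on `(D, A)` (a definition; nothing is asserted; known e.g. for CM `A` with
`A₀` simple ordinary, Ex. 4.1). [cite: Milne2009RationalTate, §4.1]
[cite: Milne2025AbelianMotivesCharP, §3.1 statement (A)] -/
def RationalityAt (D : MilneRealizationData ℚal p O) (A : AbelianVariety ℚal) : Prop :=
  ∀ (𝒜 : IntegralModel O ℚal A.X), 𝒜.IsSmoothProper A.dim →
  ∀ ⦃r s : ℕ⦄ (hrs : r + s = A.dim)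
    (t : D.P.B.W.obj ((baseChangeHom (Subfield.subtype ℚal)).obj A.X) (2 * r))
    (ζ : singularCochainComplex.cocycles ℚ ℚ
      (ComplexPoints ((baseChangeHom (Subfield.subtype ℚal)).obj A.X)) (2 * r)),
    singularCohomology.π ℚ ℚ _ (2 * r) ζ = D.P.B.isoObj _ (2 * r) t →
    HodgeTheory.IsOfHodgeType A.dim ((baseChangeHom (Subfield.subtype ℚal)).obj A.X) (2 * r) r r
      (singularCohomology.π ℂ ℂ _ (2 * r) (HodgeTheory.cocycleOfRat _ (2 * r) ζ)) →
  ∀ (Dv : Fin s → 𝒜.specialFibre.left), (∀ i, Order.coheight (Dv i) = (1 : ℕ)) →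
  ∃ q : ℚ,
    (∀ (ℓ : ℕ) [Fact ℓ.Prime] (hℓ : ℓ ≠ p),
      (D.E₀ ℓ hℓ).lefschetzPairing 𝒜.specialFibre ℚ_[ℓ] hrs (D.specializeBetti ℓ hℓ 𝒜 (2 * r) t)
        Dv = (q : ℚ_[ℓ])) ∧
    (∀ α : D.P.dR.obj A.X (2 * r),
      D.P.iso (Subfield.subtype ℚal) A.X (2 * r) (1 ⊗ₜ α) =
        twoPiI (Subfield.subtype ℚal) ^ r • ((1 : AlongHom ℂ (Subfield.subtype ℚal)) ⊗ₜ[ℚ] t) →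
      D.crys.lefschetzPairing 𝒜.specialFibre D.L hrs (D.specializeDeRham 𝒜 (2 * r) α) Dv =
        (q : D.L))

/-- Milne's Rationality Conjecture as typed in the tree — `Motives.MilneRationalityConjecture D`
(`Motives/MilneRationalityConjecture`, all abelian varieties over `ℚ^al` with good reduction at once) —
is, by `Iff.rfl`, the conjunction over `A` of the per-variety statements `RationalityAt D A`.
[cite: Milne2009RationalTate, §4.1] -/
theorem milneRationality_iff_forall (D : MilneRealizationData ℚal p O) :
    MilneRationalityConjecture D ↔ ∀ A : AbelianVariety ℚal, RationalityAt D A :=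
  Iff.rfl

/-- In particular the full Rationality Conjecture (`Motives.MilneRationalityConjecture D`) gives the
statement at every `A`. [cite: Milne2009RationalTate, §4.1] -/
theorem rationalityAt_of_milneRationality {D : MilneRealizationData ℚal p O}
    (h : MilneRationalityConjecture D) (A : AbelianVariety ℚal) : RationalityAt D A :=
  h A

/-! ### Statement (a) of Theorem 4.3: the §4.1 statement for all CM abelian varieties over `ℚ^al` -/

/-- **Statement (a) of Milne 2009, Theorem 4.3** (the theorem is quoted in the module docstring):
Milne's §4.1 rationality statement *for all CM abelian varieties over `ℚ^al`* — relative to the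
realization data `D`: `RationalityAt D A` for every abelian variety `A/ℚ^al` whose complexification
`A_ℂ = A.baseChange ℂ` is of CM-type (`Milne1999.IsOfCMType`; §3.1: a CM abelian variety is one "with
sufficiently many endomorphisms over an algebraically closed field of characteristic zero", and "The
functor `A ⇝ A_ℂ` from CM abelian varieties over `ℚ^al` to CM abelian varieties over `ℂ` is an
equivalence of categories"). By Thm. 4.3 (print; not typed) statement (a) is EQUIVALENT to (c), the
existence of a good theory of rational Tate classes on `𝒮₀`, and to (d), the diagram (18) of motives
over `𝔽`. A PREDICATE on `D` (a definition; nothing is asserted — it is the conclusion of the edge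
`rationalityCM_of_HC_CM` below). [cite: Milne2009RationalTate, Thm. 4.3 (a) and §3.1] -/
def RationalityCM (D : MilneRealizationData ℚal p O) : Prop :=
  ∀ A : AbelianVariety ℚal, Milne1999.IsOfCMType (A.baseChange ℂ) → RationalityAt D A

/-- The full Rationality Conjecture (`Motives.MilneRationalityConjecture D`, all `A`) contains
statement (a) of Thm. 4.3 (CM `A`). [cite: Milne2009RationalTate, Thm. 4.3 (a)] -/
theorem rationalityCM_of_milneRationality {D : MilneRealizationData ℚal p O}
    (h : MilneRationalityConjecture D) : RationalityCM D :=
  fun A _ ↦ h A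

/-! ### "… is implied by the Hodge conjecture for abelian varieties" (§4.1 ¶3; Milne 2025 Plain 3.2) -/

/-- **Milne 2009, §4.1, the sentence after the statement (= Milne 2025, Plain 3.2)** — both quoted
verbatim in the module docstring: the §4.1 statement "is true for a particular `γ` if `γ₀` is algebraic"
and is therefore implied, AT EACH abelian variety `A/ℚ^al`, by the algebraicity of the Hodge classes of
`A` (Plain 3.2, second sentence, quoted in the module docstring). Rendered: the tree's REAL per-variety
Hodge statement — the one the summit `Statement.lean` quantifies: a Hodge model exists and every rational
`(r,r)`-class lies in the span of the classes of algebraic cycles — at the complexified scheme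
`(baseChangeHom (Subfield.subtype ℚ^al)).obj A.X` in dimension `A.dim` — the very scheme and dimension
over which `RationalityAt` reads its Hodge classes — implies `RationalityAt D A`. A `D`-parametrised
cited PREDICATE: a THEOREM in print at the intended data `D` (an algebraic class specializes to an
algebraic class, Fulton §20.3, and the intersection numbers of algebraic cycles with divisors are
integers in every cohomology theory), NOT asserted for arbitrary data of type `MilneRealizationData`,
whose axioms say nothing about cycle classes under specialization — the standing of
`Milne1999.Theorem71` / `MilneRamachandran2006.Theorem110` / `Motives.TateImpliesHodgeAbelianStatement`.
No `_holds` is owed or claimed. [cite: Milne2009RationalTate, §4.1]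
[cite: Milne2025AbelianMotivesCharP, Plain 3.2] -/
def HodgeImpliesRationality (D : MilneRealizationData ℚal p O) : Prop :=
  ∀ A : AbelianVariety ℚal,
    HodgeConjectureFor A.dim ((baseChangeHom (Subfield.subtype ℚal)).obj A.X) → RationalityAt D A

/-- At a single `A/ℚ^al`: Milne's §4.1 implication at `D` (`HodgeImpliesRationality`), the hypothesis
(H) of Milne 1999 Thm. 7.1 at the complex abelian variety `A_ℂ = A.baseChange ℂ`
(`Milne1999.CMHodgeHypothesisAt`: if `A_ℂ` is smooth projective and of CM-type then
`HodgeConjectureFor (A.baseChange ℂ).dim (A.baseChange ℂ).X`) and the CM-type of `A_ℂ` give Milne's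
rationality statement at `A`. Bookkeeping only: `A_ℂ` is smooth projective
(`AbelianVariety.isSmoothProjective_holds`), `dim A_ℂ = dim A` (`AbelianVariety.dim_baseChange`), and
`(A.baseChange ℂ).X` is `(baseChangeHom (Subfield.subtype ℚ^al)).obj A.X` definitionally
(`algebraMap ℚ^al ℂ = Subfield.subtype`, Mathlib `Subfield.algebraMap_ofSubfield`).
[cite: Milne2009RationalTate, §4.1] -/
theorem rationalityAt_of_cmHodgeHypothesisAt {D : MilneRealizationData ℚal p O}
    (h41 : HodgeImpliesRationality D) (A : AbelianVariety ℚal)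
    (hH : Milne1999.CMHodgeHypothesisAt (A.baseChange ℂ))
    (hCM : Milne1999.IsOfCMType (A.baseChange ℂ)) : RationalityAt D A := by
  refine h41 A ?_
  have h : HodgeConjectureFor (A.baseChange ℂ).dim (A.baseChange ℂ).X :=
    hH AbelianVariety.isSmoothProjective_holds hCM
  rwa [AbelianVariety.dim_baseChange] at h

/-- **The edge `HC_CM` ⟹ Milne 2009 Theorem 4.3 (a), by name.** Given Milne's §4.1 implication ("the
conjecture is implied by the Hodge conjecture for abelian varieties"; Milne 2025 Plain 3.2) at the
realization data `D`, and the Hodge conjecture for every complex abelian variety of CM-type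
(`∀ B, Milne1999.CMHodgeHypothesisAt B` = the summit item `CMAbelianHodge` definitionally = the
hypothesis of `Milne1999.tateAV_Fq_of_HC_CM`), Milne's Rationality Conjecture holds for every CM abelian
variety over `ℚ^al` with good reduction at `O` — statement (a) of Thm. 4.3 (`RationalityCM D`), hence,
in print (Thm. 4.3, not typed), (c) a good theory of rational Tate classes on `𝒮₀` (unique: Thm. 3.3)
and (d) the commutative diagram (18) of tannakian categories of motives over `𝔽` with its fibre
functors. (Introduction: "the Hodge conjecture for CM abelian varieties over `ℂ` implies the rationality
conjecture".) [cite: Milne2009RationalTate, §4.1 and Thm. 4.3 (a)] -/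
theorem rationalityCM_of_HC_CM {D : MilneRealizationData ℚal p O}
    (h41 : HodgeImpliesRationality D) (hHC : ∀ B : AbelianVariety ℂ, Milne1999.CMHodgeHypothesisAt B) :
    RationalityCM D :=
  fun A hCM ↦ rationalityAt_of_cmHodgeHypothesisAt h41 A (hHC (A.baseChange ℂ)) hCM

/-- Variant over the FULL Hodge conjecture for complex abelian varieties (Milne's own hypothesis in
§4.1: "implied by the Hodge conjecture for abelian varieties"): the Rationality Conjecture then holds
for EVERY abelian variety over `ℚ^al` with good reduction, i.e. the tree's
`Motives.MilneRationalityConjecture D`. [cite: Milne2009RationalTate, §4.1] -/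
theorem milneRationality_of_hodge_abelianVarieties {D : MilneRealizationData ℚal p O}
    (h41 : HodgeImpliesRationality D)
    (hHC : ∀ B : AbelianVariety ℂ, IsSmoothProjective B.dim B.X → HodgeConjectureFor B.dim B.X) :
    MilneRationalityConjecture D := by
  intro A
  refine h41 A ?_
  have h : HodgeConjectureFor (A.baseChange ℂ).dim (A.baseChange ℂ).X :=
    hHC (A.baseChange ℂ) AbelianVariety.isSmoothProjective_holds
  rwa [AbelianVariety.dim_baseChange] at h

end Literature.AlgebraicGeometry.Milne2009

end
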